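import Summits.QuantumFields.BalabanUV.T4Continuum.Support.NE3ProductPathChart
import HarnessLib

/-!
# T⁴ programme, node NE3 — route Π, file 3a of D-ne3p1-g25-1 §4 ∕ ruling ρ-g25-2 (4): THE PRE-SIZES OF THE LINEAR NORMAL PART FROM
# LETTERS — the ν-letter is M-FREE by pure counting once (i) the right inverse has the smooth-lift letters, (ii) the linearised average of the
# relative field obeys the LOCAL quadratic (sup) bound, (iii) the relative field has a SQUARE-SUMMABLE LOCAL SUP MAJORANT (Π-REG)

NE3 (node U1b), row NE3 OWNER `b2b-balaban-t4-ne3-p1` (gen 25).  ABSTRACT IN THE LETTERS: this file names no supplier; its hypotheses are the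
displayed letter SHAPES that route Π's kernel files deliver — (R1)–(R4) of leaf-01's smooth right inverse (`NE3SmoothLift*`∕`NE3SmoothRightInverse*`
flat ✓, curved Π-R-W in flight), the local quadratic bound of the k-fold average's remainder (leaf-02's Π-C-3 `NE3QuadRemainderSup.norm_relIter_sub_dirIter_le`
✓ + `NE3QuadRemainderLocality` ✓, read at the relative field of a residual representative, for which `dirIter X₀ = −(relIter − dirIter) X₀` by
file 1's fibre equation), and the majorant (Π-REG) — so that the instantiation files only plug names.

THE COUNTING (`M = L^k`, `F = periodBox (N·M)`, coarse box `periodBox N`, `X := Nn − X₀`, `S := Σ_{z,κ} m(z,κ)²`, `T := dirSq X₀ F`):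
`dirSq φ ≤ C₂²M⁴α₀²·S ≤ C₂²C²α₀²·M^{4−d}·T`, `dirL1 φ ≤ C₂M²·S ≤ C₂C²M^{2−d}·T`;
`‖Nn‖_w² = curlSq + M^{−2}dirSq ≤ (c₁+c₂)M^{d−4}·dirSq φ ≤ (c₁+c₂)C₂²C²α₀²·T`; `T ≤ 2·dirSq X + 2·dirSq Nn ≤ 2M²(‖X‖_w² + ‖Nn‖_w²)`;
hence with `ρ² := 2(c₁+c₂)C₂²C²(α₀M)² ≤ 1∕2`: **`‖Nn‖_w ≤ 2√(c₁+c₂)·C₂·C·(α₀M)·‖X‖_w`** (the ν-letter, `α̂₀ = α₀M`), `T ≤ 4M²‖X‖_w²`,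
**`a·Σ‖curl_W Nn‖ ≤ 4c₃C₂C²·(aM²)·‖X‖_w²`**, **`a·((α₀+αN)·dirL1 Nn) ≤ 4c₄C₂C²·(aM²)·((α₀+αN)M)·‖X‖_w² ≤ 4c₄C₂C²(aM²)‖X‖_w²`** — every
`M` cancels: the letters `α₀M`, `aM²`, `(α₀+αN)M` are the k-free (J1)∕(J2) currencies of the chart.

CONTENT (0 sorry, 1 shape): §1 `LocalSupMajorant` [(Π-REG) — B11 Thm 1∕Prop 2 regularity TYPE; typed leaf, ours in form; asserted for nothing];
§2 `dirSq_coarse_le`, `dirL1_coarse_le`, `dirSq_sub_le_two`, **`preSizes_of_letters`**.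

HONEST FRAMING.  Real-number bookkeeping on OUR displayed letters; the letters, the majorant and the fibre equation are HYPOTHESES here;
(P♮)_W's numeric lines, (H∃), T-E_w♯ and NE3 are NOT proved; spine PROVED 0∕9; finite T⁴ rung (B)+1 — NOT infinite volume, NOT mass gap, NOT
`BetaPertH`, NOT Clay.  PLACEMENT: `Summits/QuantumFields/BalabanUV/`.  HONEST DEPENDENCY: continuum YM on T⁴ ⇐ BetaPertH ∧ nine spine estimates
(0/9 proved); BetaPertH ⇐ (D1) ∧ (D4) ∧ CAP+tail; G-an2-4 gates asym, D1 and NE2/3/4.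
-/

set_option autoImplicit false

open scoped BigOperators Matrix.Norms.L2Operator
open NormedSpace Finset

namespace Summit.QuantumFields.BalabanUV.T4Continuum.NE3LinearNormalPartPreSizes

open Literature.MathematicalPhysics.QuantumFieldTheory.Balaban1983to89
open B7Prop1Explicit B7Prop2Explicit B7Prop1Local
open T4AveragingDeficitWall (IsUnitaryCfg curl curlSq dirSq dirL1)
open T4AveragingDeficitWallBoundary (periodBox)
open MinimalActionLevels (perWin)
open NE3EnergyWeightedShapes (energyNormW energyNormW_nonneg)
open NE3EnergyHessContTwoTerm (curlSq_nonneg dirSq_nonneg)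
open NE3LocalCrudeWPair (dirSq_le_pow_sq_mul_energyNormW_sq)
open AveragingDeficitDerivCore (dirL1_nonneg)
open NE3ProductPathBounds (energySq_nonneg)

noncomputable section

variable {d : ℕ} {n : Type*} [Fintype n] [DecidableEq n]

/-! ## §1 The square-summable local sup majorant (Π-REG) -/

/-- **(Π-REG) — A SQUARE-SUMMABLE LOCAL SUP MAJORANT OF A BOND FIELD AT LEVEL `k`** (period `N·L^k`): a non-negative function `m` on the
coarse bonds `(z,κ)` majorising `‖X₀ b‖` on the block union `B^k(c₋) ∪ B^k(c₊)` feeding `(z,κ)` (the box of record `loK`∕`bondHiK`), whose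
squares, summed over the coarse period box and weighted by the block volume `(L^k)^d`, are dominated by `C²·dirSq X₀` over the fine period
box — «the field is locally comparable to its quadratic mean at the unit scale».  A hypothesis SHAPE asserted for nothing (B11 Thm 1∕Prop 2
regularity TYPE for the relative field of a minimiser pair; ours in form). [folklore] -/
@[folklore]
structure LocalSupMajorant (L N k : ℕ) (X₀ : Site d → Fin d → Matrix n n ℂ) (m : Site d → Fin d → ℝ) (C : ℝ) : Prop where
  /-- the majorant is non-negative -/
  nonneg : ∀ (z : Site d) (κ : Fin d), 0 ≤ m z κ
  /-- the majorant dominates the field on the block union feeding each coarse bond -/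
  dom : ∀ (z : Site d) (κ : Fin d) (x : Site d) (μ : Fin d), InBox (loK L k z) (bondHiK L k z κ) x →
    InBox (loK L k z) (bondHiK L k z κ) (x + e μ) → ‖X₀ x μ‖ ≤ m z κ
  /-- the constant is non-negative -/
  hC : 0 ≤ C
  /-- SQUARE-SUMMABILITY: `(L^k)^d · Σ_{z ∈ periodBox N} Σ_κ m(z,κ)² ≤ C² · dirSq X₀ (periodBox (N·L^k))` -/
  sq : ((L : ℝ) ^ k) ^ d * ∑ z ∈ periodBox (d := d) N, ∑ κ : Fin d, m z κ ^ 2 ≤ C ^ 2 * dirSq X₀ (periodBox (d := d) (N * L ^ k))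

/-! ## §2 The counting -/

/-- **THE COARSE ℓ² SIZE FROM THE LOCAL QUADRATIC BOUND AND THE MAJORANT**: if `‖φ(z,κ)‖ ≤ C₂·(M·m(z,κ))²`, `0 ≤ m ≤ α₀` and
`M^d·Σm² ≤ C²·T`, then `M^d · dirSq φ (periodBox N) ≤ C₂²·α₀²·M⁴·C²·T`. [folklore] -/
theorem dirSq_coarse_le {N : ℕ} {φ : Site d → Fin d → Matrix n n ℂ} {m : Site d → Fin d → ℝ} {M C₂ C α₀ T : ℝ} (hM : 0 ≤ M)
    (hm0 : ∀ z κ, 0 ≤ m z κ) (hmα : ∀ z κ, m z κ ≤ α₀)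
    (hφ : ∀ z ∈ periodBox (d := d) N, ∀ κ : Fin d, ‖φ z κ‖ ≤ C₂ * (M * m z κ) ^ 2)
    (hsq : M ^ d * ∑ z ∈ periodBox (d := d) N, ∑ κ : Fin d, m z κ ^ 2 ≤ C ^ 2 * T) :
    M ^ d * dirSq φ (periodBox (d := d) N) ≤ C₂ ^ 2 * α₀ ^ 2 * M ^ 4 * (C ^ 2 * T) := by
  have hpt : ∀ z ∈ periodBox (d := d) N, ∀ κ : Fin d, ‖φ z κ‖ ^ 2 ≤ C₂ ^ 2 * α₀ ^ 2 * M ^ 4 * m z κ ^ 2 := by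
    intro z hz κ
    have h1 := hφ z hz κ
    have h0 : 0 ≤ ‖φ z κ‖ := norm_nonneg _
    have hmz := hm0 z κ
    have hma := hmα z κ
    have h2 : ‖φ z κ‖ ^ 2 ≤ (C₂ * (M * m z κ) ^ 2) ^ 2 := pow_le_pow_left₀ h0 h1 2
    have h3 : (C₂ * (M * m z κ) ^ 2) ^ 2 = C₂ ^ 2 * M ^ 4 * m z κ ^ 2 * m z κ ^ 2 := by ring
    have h4 : m z κ ^ 2 ≤ α₀ ^ 2 := pow_le_pow_left₀ hmz hma 2
    have h5 : C₂ ^ 2 * M ^ 4 * m z κ ^ 2 * m z κ ^ 2 ≤ C₂ ^ 2 * M ^ 4 * m z κ ^ 2 * α₀ ^ 2 :=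
      mul_le_mul_of_nonneg_left h4 (by positivity)
    nlinarith
  have hsum : dirSq φ (periodBox (d := d) N) ≤ C₂ ^ 2 * α₀ ^ 2 * M ^ 4 * ∑ z ∈ periodBox (d := d) N, ∑ κ : Fin d, m z κ ^ 2 := by
    unfold dirSq
    rw [Finset.mul_sum]
    refine Finset.sum_le_sum fun z hz => ?_
    rw [Finset.mul_sum]
    exact Finset.sum_le_sum fun κ _ => hpt z hz κ
  have hMd : 0 ≤ M ^ d := by positivity
  calc M ^ d * dirSq φ (periodBox (d := d) N) ≤ M ^ d * (C₂ ^ 2 * α₀ ^ 2 * M ^ 4 * ∑ z ∈ periodBox (d := d) N, ∑ κ : Fin d, m z κ ^ 2) :=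
        mul_le_mul_of_nonneg_left hsum hMd
    _ = C₂ ^ 2 * α₀ ^ 2 * M ^ 4 * (M ^ d * ∑ z ∈ periodBox (d := d) N, ∑ κ : Fin d, m z κ ^ 2) := by ring
    _ ≤ C₂ ^ 2 * α₀ ^ 2 * M ^ 4 * (C ^ 2 * T) := mul_le_mul_of_nonneg_left hsq (by positivity)

/-- **THE COARSE ℓ¹ SIZE**: under the same data, `M^d · dirL1 φ (periodBox N) ≤ C₂·M²·C²·T`. [folklore] -/
theorem dirL1_coarse_le {N : ℕ} {φ : Site d → Fin d → Matrix n n ℂ} {m : Site d → Fin d → ℝ} {M C₂ C T : ℝ} (hM : 0 ≤ M)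
    (hC₂ : 0 ≤ C₂) (hφ : ∀ z ∈ periodBox (d := d) N, ∀ κ : Fin d, ‖φ z κ‖ ≤ C₂ * (M * m z κ) ^ 2)
    (hsq : M ^ d * ∑ z ∈ periodBox (d := d) N, ∑ κ : Fin d, m z κ ^ 2 ≤ C ^ 2 * T) :
    M ^ d * dirL1 φ (periodBox (d := d) N) ≤ C₂ * M ^ 2 * (C ^ 2 * T) := by
  have hsum : dirL1 φ (periodBox (d := d) N) ≤ C₂ * M ^ 2 * ∑ z ∈ periodBox (d := d) N, ∑ κ : Fin d, m z κ ^ 2 := by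
    unfold dirL1
    rw [Finset.mul_sum]
    refine Finset.sum_le_sum fun z hz => ?_
    rw [Finset.mul_sum]
    refine Finset.sum_le_sum fun κ _ => ?_
    have h := hφ z hz κ
    have : C₂ * (M * m z κ) ^ 2 = C₂ * M ^ 2 * m z κ ^ 2 := by ring
    linarith
  have hMd : 0 ≤ M ^ d := by positivity
  calc M ^ d * dirL1 φ (periodBox (d := d) N) ≤ M ^ d * (C₂ * M ^ 2 * ∑ z ∈ periodBox (d := d) N, ∑ κ : Fin d, m z κ ^ 2) :=
        mul_le_mul_of_nonneg_left hsum hMd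
    _ = C₂ * M ^ 2 * (M ^ d * ∑ z ∈ periodBox (d := d) N, ∑ κ : Fin d, m z κ ^ 2) := by ring
    _ ≤ C₂ * M ^ 2 * (C ^ 2 * T) := mul_le_mul_of_nonneg_left hsq (by positivity)

/-- `dirSq (Nn − X) F ≤ 2·dirSq X F + 2·dirSq Nn F` (so, with `X := Nn − X₀`: `dirSq X₀ ≤ 2 dirSq X + 2 dirSq Nn`). [folklore] -/
theorem dirSq_sub_le_two (Nn X : Site d → Fin d → Matrix n n ℂ) (F : Finset (Site d)) :
    dirSq (fun y μ => Nn y μ - X y μ) F ≤ 2 * dirSq X F + 2 * dirSq Nn F := by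
  unfold dirSq
  rw [Finset.mul_sum, Finset.mul_sum, ← Finset.sum_add_distrib]
  refine Finset.sum_le_sum fun y _ => ?_
  rw [Finset.mul_sum, Finset.mul_sum, ← Finset.sum_add_distrib]
  refine Finset.sum_le_sum fun μ _ => ?_
  have h := norm_sub_le (Nn y μ) (X y μ)
  have h0 := norm_nonneg (Nn y μ - X y μ)
  nlinarith [norm_nonneg (Nn y μ), norm_nonneg (X y μ), sq_nonneg (‖Nn y μ‖ - ‖X y μ‖)]

/-- **THE PRE-SIZES OF THE LINEAR NORMAL PART FROM THE LETTERS** (`L, N ≥ 1`, any background `W`; `M = L^k`, `F = periodBox (N·M)`,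
`X := Nn − X₀`).  HYPOTHESES: the coarse field `φ` (in route Π: `dirIter L k W X₀`) obeys the LOCAL quadratic bound
`‖φ(z,κ)‖ ≤ C₂·(M·m(z,κ))²` against a majorant `0 ≤ m ≤ α₀` with `M^d·Σm² ≤ C²·dirSq X₀ F` ((Π-REG)); `Nn` (in route Π: `R_W φ`) obeys the
right-inverse letters (R1) `dirSq Nn F ≤ c₁(M^d∕M²)·dirSq φ`, (R2) `curlSq_W Nn F ≤ c₂(M^d∕M⁴)·dirSq φ`, (R3) `Σ_{perWin}‖curl_W Nn‖ ≤ c₃(M^d∕M²)·dirL1 φ`,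
(R4) `dirL1 Nn F ≤ c₄(M^d∕M)·dirL1 φ`; the smallness `ρ² := 2(c₁+c₂)C₂²C²(α₀M)² ≤ 1∕2`; `(α₀+αN)·M ≤ 1`; `0 ≤ a`.
CONCLUSIONS: **(N1) `‖Nn‖_w ≤ 2√(c₁+c₂)·C₂·C·(α₀M)·‖X‖_w`, (N2) `a·Σ_{perWin}‖curl_W Nn‖ ≤ 4c₃C₂C²·(aM²)·‖X‖_w²`,
(N3) `a·((α₀+αN)·dirL1 Nn F) ≤ 4c₄C₂C²·(aM²)·‖X‖_w²`.** [folklore] -/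
theorem preSizes_of_letters {L N : ℕ} (hL : 1 ≤ L) (k : ℕ) (W : Site d → Fin d → (Matrix n n ℂ)ˣ)
    {X₀ Nn : Site d → Fin d → Matrix n n ℂ} {φ : Site d → Fin d → Matrix n n ℂ} {m : Site d → Fin d → ℝ}
    {α₀ αN C₂ C c₁ c₂ c₃ c₄ a : ℝ} (hα₀ : 0 ≤ α₀) (hαN : 0 ≤ αN) (hC₂ : 0 ≤ C₂) (hC : 0 ≤ C) (hc₁ : 0 ≤ c₁) (hc₂ : 0 ≤ c₂)
    (hc₃ : 0 ≤ c₃) (hc₄ : 0 ≤ c₄) (ha : 0 ≤ a)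
    (hm0 : ∀ z κ, 0 ≤ m z κ) (hmα : ∀ z κ, m z κ ≤ α₀)
    (hsq : ((L : ℝ) ^ k) ^ d * ∑ z ∈ periodBox (d := d) N, ∑ κ : Fin d, m z κ ^ 2 ≤ C ^ 2 * dirSq X₀ (periodBox (d := d) (N * L ^ k)))
    (hφ : ∀ z ∈ periodBox (d := d) N, ∀ κ : Fin d, ‖φ z κ‖ ≤ C₂ * ((L : ℝ) ^ k * m z κ) ^ 2)
    (hR1 : dirSq Nn (periodBox (d := d) (N * L ^ k)) ≤ c₁ * (((L : ℝ) ^ k) ^ d / ((L : ℝ) ^ k) ^ 2) * dirSq φ (periodBox (d := d) N))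
    (hR2 : curlSq W Nn (periodBox (d := d) (N * L ^ k)) ≤ c₂ * (((L : ℝ) ^ k) ^ d / ((L : ℝ) ^ k) ^ 4) * dirSq φ (periodBox (d := d) N))
    (hR3 : ∑ p ∈ perWin d (N * L ^ k), ‖curl W Nn p‖ ≤ c₃ * (((L : ℝ) ^ k) ^ d / ((L : ℝ) ^ k) ^ 2) * dirL1 φ (periodBox (d := d) N))
    (hR4 : dirL1 Nn (periodBox (d := d) (N * L ^ k)) ≤ c₄ * (((L : ℝ) ^ k) ^ d / (L : ℝ) ^ k) * dirL1 φ (periodBox (d := d) N))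
    (hρ : 2 * (c₁ + c₂) * C₂ ^ 2 * C ^ 2 * (α₀ * (L : ℝ) ^ k) ^ 2 ≤ 1 / 2) (hJ1 : (α₀ + αN) * (L : ℝ) ^ k ≤ 1) :
    energyNormW L k W Nn (periodBox (d := d) (N * L ^ k))
        ≤ 2 * Real.sqrt (c₁ + c₂) * C₂ * C * (α₀ * (L : ℝ) ^ k) * energyNormW L k W (fun y μ => Nn y μ - X₀ y μ) (periodBox (d := d) (N * L ^ k)) ∧
      a * ∑ p ∈ perWin d (N * L ^ k), ‖curl W Nn p‖
        ≤ 4 * c₃ * C₂ * C ^ 2 * (a * ((L : ℝ) ^ k) ^ 2) * energyNormW L k W (fun y μ => Nn y μ - X₀ y μ) (periodBox (d := d) (N * L ^ k)) ^ 2 ∧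
      a * ((α₀ + αN) * dirL1 Nn (periodBox (d := d) (N * L ^ k)))
        ≤ 4 * c₄ * C₂ * C ^ 2 * (a * ((L : ℝ) ^ k) ^ 2) * energyNormW L k W (fun y μ => Nn y μ - X₀ y μ) (periodBox (d := d) (N * L ^ k)) ^ 2 := by
  -- abbreviations as plain reals
  set M : ℝ := (L : ℝ) ^ k with hMdef
  set F := periodBox (d := d) (N * L ^ k) with hFdef
  set T : ℝ := dirSq X₀ F with hTdef
  set EX : ℝ := energyNormW L k W (fun y μ => Nn y μ - X₀ y μ) F with hEXdef
  set EN : ℝ := energyNormW L k W Nn F with hENdef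
  have hM1 : 1 ≤ M := one_le_pow₀ (by exact_mod_cast hL)
  have hM0 : 0 < M := by linarith
  have hMd0 : 0 < M ^ d := by positivity
  have hEX0 : 0 ≤ EX := energyNormW_nonneg L k W _ F
  have hEN0 : 0 ≤ EN := energyNormW_nonneg L k W _ F
  have hT0 : 0 ≤ T := dirSq_nonneg _ _
  -- (a)(b): the coarse sizes of `φ`
  have hφ2 : M ^ d * dirSq φ (periodBox (d := d) N) ≤ C₂ ^ 2 * α₀ ^ 2 * M ^ 4 * (C ^ 2 * T) :=
    dirSq_coarse_le hM0.le hm0 hmα hφ hsq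
  have hφ1 : M ^ d * dirL1 φ (periodBox (d := d) N) ≤ C₂ * M ^ 2 * (C ^ 2 * T) := dirL1_coarse_le hM0.le hC₂ hφ hsq
  -- (e): `EN² = curlSq + M⁻²·dirSq ≤ (c₁+c₂)·(M^d/M⁴)·dirSq φ ≤ (c₁+c₂)C₂²C²α₀²·T`
  have hENsq : EN ^ 2 = curlSq W Nn F + (M⁻¹) ^ 2 * dirSq Nn F := by
    rw [hENdef]; unfold NE3EnergyWeightedShapes.energyNormW
    rw [Real.sq_sqrt (energySq_nonneg L k W Nn F)]
  have hdφ0 : 0 ≤ dirSq φ (periodBox (d := d) N) := dirSq_nonneg _ _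
  have hEN2 : EN ^ 2 ≤ (c₁ + c₂) * C₂ ^ 2 * C ^ 2 * α₀ ^ 2 * T := by
    -- `M^d·EN² ≤ (c₁+c₂)·(M^d)·(M^d/M⁴)·dirSq φ·…`; cleaner: multiply through by `M^d`
    have h1 : (M⁻¹) ^ 2 * dirSq Nn F ≤ (M⁻¹) ^ 2 * (c₁ * (M ^ d / M ^ 2) * dirSq φ (periodBox (d := d) N)) :=
      mul_le_mul_of_nonneg_left hR1 (by positivity)
    have h2 : (M⁻¹) ^ 2 * (c₁ * (M ^ d / M ^ 2) * dirSq φ (periodBox (d := d) N)) = c₁ * (M ^ d / M ^ 4) * dirSq φ (periodBox (d := d) N) := by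
      field_simp
    have h3 : EN ^ 2 ≤ (c₁ + c₂) * (M ^ d / M ^ 4) * dirSq φ (periodBox (d := d) N) := by
      rw [hENsq]
      have h12 := add_le_add hR2 h1
      rw [h2] at h12
      have : c₂ * (M ^ d / M ^ 4) * dirSq φ (periodBox (d := d) N) + c₁ * (M ^ d / M ^ 4) * dirSq φ (periodBox (d := d) N)
          = (c₁ + c₂) * (M ^ d / M ^ 4) * dirSq φ (periodBox (d := d) N) := by ring
      linarith
    have h4 : (c₁ + c₂) * (M ^ d / M ^ 4) * dirSq φ (periodBox (d := d) N) = (c₁ + c₂) / M ^ 4 * (M ^ d * dirSq φ (periodBox (d := d) N)) := by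
      field_simp
    have h5 : (c₁ + c₂) / M ^ 4 * (M ^ d * dirSq φ (periodBox (d := d) N)) ≤ (c₁ + c₂) / M ^ 4 * (C₂ ^ 2 * α₀ ^ 2 * M ^ 4 * (C ^ 2 * T)) :=
      mul_le_mul_of_nonneg_left hφ2 (by positivity)
    have h6 : (c₁ + c₂) / M ^ 4 * (C₂ ^ 2 * α₀ ^ 2 * M ^ 4 * (C ^ 2 * T)) = (c₁ + c₂) * C₂ ^ 2 * C ^ 2 * α₀ ^ 2 * T := by
      field_simp
    exact h3.trans (by rw [h4]; exact h5.trans h6.le)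
  -- (c)(d): `T ≤ 2M²(EX² + EN²)`
  have hTle : T ≤ 2 * M ^ 2 * (EX ^ 2 + EN ^ 2) := by
    have h1 : T ≤ 2 * dirSq (fun y μ => Nn y μ - X₀ y μ) F + 2 * dirSq Nn F := by
      have h := dirSq_sub_le_two Nn (fun y μ => Nn y μ - X₀ y μ) F
      have hX₀ : (fun y μ => Nn y μ - (fun y μ => Nn y μ - X₀ y μ) y μ) = X₀ := by funext y μ; simp
      rw [hX₀] at h
      exact h
    have h2 : dirSq (fun y μ => Nn y μ - X₀ y μ) F ≤ M ^ 2 * EX ^ 2 := by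
      rw [hEXdef, hMdef]; exact dirSq_le_pow_sq_mul_energyNormW_sq hL k W (fun y μ => Nn y μ - X₀ y μ) F
    have h3 : dirSq Nn F ≤ M ^ 2 * EN ^ 2 := by
      rw [hENdef, hMdef]; exact dirSq_le_pow_sq_mul_energyNormW_sq hL k W Nn F
    have h4 : 2 * M ^ 2 * (EX ^ 2 + EN ^ 2) = 2 * (M ^ 2 * EX ^ 2) + 2 * (M ^ 2 * EN ^ 2) := by ring
    linarith
  -- absorption: `EN² ≤ ρ²(EX² + EN²)` with `ρ² ≤ 1/2` ⟹ `EN² ≤ 2ρ²·EX²`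
  set ρ2 : ℝ := 2 * (c₁ + c₂) * C₂ ^ 2 * C ^ 2 * (α₀ * M) ^ 2 with hρ2def
  have hρ2_0 : 0 ≤ ρ2 := by positivity
  have hENρ : EN ^ 2 ≤ ρ2 * (EX ^ 2 + EN ^ 2) := by
    have h1 : (c₁ + c₂) * C₂ ^ 2 * C ^ 2 * α₀ ^ 2 * T ≤ (c₁ + c₂) * C₂ ^ 2 * C ^ 2 * α₀ ^ 2 * (2 * M ^ 2 * (EX ^ 2 + EN ^ 2)) :=
      mul_le_mul_of_nonneg_left hTle (by positivity)
    have h2 : (c₁ + c₂) * C₂ ^ 2 * C ^ 2 * α₀ ^ 2 * (2 * M ^ 2 * (EX ^ 2 + EN ^ 2)) = ρ2 * (EX ^ 2 + EN ^ 2) := by rw [hρ2def]; ring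
    linarith [hEN2]
  have hEN2X : EN ^ 2 ≤ 2 * ρ2 * EX ^ 2 := by
    have h1 : ρ2 * EN ^ 2 ≤ 1 / 2 * EN ^ 2 := mul_le_mul_of_nonneg_right hρ (sq_nonneg EN)
    have h2 : ρ2 * (EX ^ 2 + EN ^ 2) = ρ2 * EX ^ 2 + ρ2 * EN ^ 2 := by ring
    linarith
  -- (N1): `EN ≤ √(2ρ²)·EX = 2√(c₁+c₂)·C₂·C·(α₀M)·EX`
  have hN1 : EN ≤ 2 * Real.sqrt (c₁ + c₂) * C₂ * C * (α₀ * M) * EX := by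
    have hK0 : 0 ≤ 2 * Real.sqrt (c₁ + c₂) * C₂ * C * (α₀ * M) := by positivity
    have hK2 : (2 * Real.sqrt (c₁ + c₂) * C₂ * C * (α₀ * M)) ^ 2 = 2 * ρ2 := by
      rw [hρ2def, mul_pow, mul_pow, mul_pow, mul_pow, Real.sq_sqrt (by positivity)]; ring
    have h1 : EN ^ 2 ≤ (2 * Real.sqrt (c₁ + c₂) * C₂ * C * (α₀ * M) * EX) ^ 2 := by rw [mul_pow, hK2]; linarith
    exact (pow_le_pow_iff_left₀ hEN0 (mul_nonneg hK0 hEX0) two_ne_zero).mp h1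
  -- `T ≤ 4M²·EX²`
  have hT4 : T ≤ 4 * M ^ 2 * EX ^ 2 := by
    have h1 : M ^ 2 * EN ^ 2 ≤ M ^ 2 * (2 * ρ2 * EX ^ 2) := mul_le_mul_of_nonneg_left hEN2X (by positivity)
    have h2 : ρ2 * (M ^ 2 * EX ^ 2) ≤ 1 / 2 * (M ^ 2 * EX ^ 2) := mul_le_mul_of_nonneg_right hρ (mul_nonneg (pow_nonneg hM0.le 2) (sq_nonneg EX))
    have h3 : M ^ 2 * (2 * ρ2 * EX ^ 2) = 2 * (ρ2 * (M ^ 2 * EX ^ 2)) := by ring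
    have h4 : 2 * M ^ 2 * (EX ^ 2 + EN ^ 2) = 2 * (M ^ 2 * EX ^ 2) + 2 * (M ^ 2 * EN ^ 2) := by ring
    linarith
  -- (N2): the ℓ¹-curl
  have hN2 : a * ∑ p ∈ perWin d (N * L ^ k), ‖curl W Nn p‖ ≤ 4 * c₃ * C₂ * C ^ 2 * (a * M ^ 2) * EX ^ 2 := by
    -- `M^d·Σ‖curl‖ ≤ c₃·(M^d/M²)·(M^d·dirL1 φ)·… `; multiply (R3) by `M^d` and use `hφ1`
    have h1 : M ^ d * ∑ p ∈ perWin d (N * L ^ k), ‖curl W Nn p‖ ≤ c₃ * (M ^ d / M ^ 2) * (M ^ d * dirL1 φ (periodBox (d := d) N)) := by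
      have := mul_le_mul_of_nonneg_left hR3 hMd0.le; linarith [this]
    have h2 : c₃ * (M ^ d / M ^ 2) * (M ^ d * dirL1 φ (periodBox (d := d) N)) ≤ c₃ * (M ^ d / M ^ 2) * (C₂ * M ^ 2 * (C ^ 2 * T)) :=
      mul_le_mul_of_nonneg_left hφ1 (by positivity)
    have h3 : c₃ * (M ^ d / M ^ 2) * (C₂ * M ^ 2 * (C ^ 2 * T)) = M ^ d * (c₃ * C₂ * C ^ 2 * T) := by field_simp
    have h4 : ∑ p ∈ perWin d (N * L ^ k), ‖curl W Nn p‖ ≤ c₃ * C₂ * C ^ 2 * T :=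
      le_of_mul_le_mul_left (h1.trans (h2.trans h3.le)) hMd0
    have h5 : c₃ * C₂ * C ^ 2 * T ≤ c₃ * C₂ * C ^ 2 * (4 * M ^ 2 * EX ^ 2) := mul_le_mul_of_nonneg_left hT4 (by positivity)
    have h6 := mul_le_mul_of_nonneg_left (h4.trans h5) ha
    linarith [h6]
  -- (N3): the ℓ¹ size with the (J1) factor
  have hN3 : a * ((α₀ + αN) * dirL1 Nn F) ≤ 4 * c₄ * C₂ * C ^ 2 * (a * M ^ 2) * EX ^ 2 := by
    have h1 : M ^ d * dirL1 Nn F ≤ c₄ * (M ^ d / M) * (M ^ d * dirL1 φ (periodBox (d := d) N)) := by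
      have := mul_le_mul_of_nonneg_left hR4 hMd0.le; linarith [this]
    have h2 : c₄ * (M ^ d / M) * (M ^ d * dirL1 φ (periodBox (d := d) N)) ≤ c₄ * (M ^ d / M) * (C₂ * M ^ 2 * (C ^ 2 * T)) :=
      mul_le_mul_of_nonneg_left hφ1 (by positivity)
    have h3 : c₄ * (M ^ d / M) * (C₂ * M ^ 2 * (C ^ 2 * T)) = M ^ d * (c₄ * C₂ * C ^ 2 * M * T) := by field_simp
    have h4 : dirL1 Nn F ≤ c₄ * C₂ * C ^ 2 * M * T := le_of_mul_le_mul_left (h1.trans (h2.trans h3.le)) hMd0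
    have h5 : c₄ * C₂ * C ^ 2 * M * T ≤ c₄ * C₂ * C ^ 2 * M * (4 * M ^ 2 * EX ^ 2) := mul_le_mul_of_nonneg_left hT4 (by positivity)
    have h6 : (α₀ + αN) * dirL1 Nn F ≤ (α₀ + αN) * (c₄ * C₂ * C ^ 2 * M * (4 * M ^ 2 * EX ^ 2)) :=
      mul_le_mul_of_nonneg_left (h4.trans h5) (by positivity)
    -- `(α₀+αN)·M ≤ 1`
    have h7 : (α₀ + αN) * (c₄ * C₂ * C ^ 2 * M * (4 * M ^ 2 * EX ^ 2)) = ((α₀ + αN) * M) * (4 * c₄ * C₂ * C ^ 2 * M ^ 2 * EX ^ 2) := by ring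
    have h8 : ((α₀ + αN) * M) * (4 * c₄ * C₂ * C ^ 2 * M ^ 2 * EX ^ 2) ≤ 1 * (4 * c₄ * C₂ * C ^ 2 * M ^ 2 * EX ^ 2) :=
      mul_le_mul_of_nonneg_right hJ1 (mul_nonneg (by positivity : (0:ℝ) ≤ 4 * c₄ * C₂ * C ^ 2 * M ^ 2) (sq_nonneg EX))
    have h9 := mul_le_mul_of_nonneg_left (h6.trans (by linarith [h7, h8] : _ ≤ 1 * (4 * c₄ * C₂ * C ^ 2 * M ^ 2 * EX ^ 2))) ha
    linarith [h9]
  exact ⟨hN1, hN2, hN3⟩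

end

end Summit.QuantumFields.BalabanUV.T4Continuum.NE3LinearNormalPartPreSizes
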